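import Summits.ResolutionOfSingularities.ResolutionOfSingularities.Theorems.ShadeCutShadeTwo
import HarnessLib

/-!
# MaxContactCutShadeCut — decomp-res node «ShadeCut» (lens-3 g16), tree file 4/4 (Theses cone): §K BOOKING —
the shade axis of the joint
residual of aside 31770 `MaxContactCut.DefectWalksDeep`: WINDOW `s = 2` DECIDED (`NoShadeTwoJointTailsDeep`, PROVED
EMPTY `noShadeTwoJointTails_holds`),
residual RE-LOCATED at `s ≥ 3` (`NoJointTailsFromThreeDeep`; EXACT `joint_iff_three`, `defectWalksDeep_iff_three`,
hypothesis-free; 31770 BY NAME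
`defectWalksDeep_of_three`; necessity `three_of_defectWalksDeep`); §L lens-3 letters: g15's located residual cut
along the same axis
(`NoMixedTailsFromThreeDeep`, `NoTameMixedTailsFromThreeDeep`, EXACT `mixed_iff_fromThree` /
`tameMixed_iff_fromThree` over the landed
`ConeCutClasses`).  No aside is booked from this file: per critic row 136 the ONE located-residual aside of the
shade axis is lens-3 g17's sharper
`NoJointTailsFromFourDeep` (node «TightCut», landing next), which supersedes `NoJointTailsFromThreeDeep`.

Content VERBATIM from the decomp-res lens-3 g16 file `HOME/decomp-res-lens-3/g16/ShadeCut.lean` (sha256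
d031e7e4ff78d2a8…, 1829 l; CRITIC-LEDGER
row 130 CLEARED (DECIDED +1 · MAP +1), landing orders 2026-08-30T18:2xZ (row 130 rider) / 19:49:35Z (row 136:
ShadeCut FIRST, then lens-3 g17
«TightCut» as modules importing these)).  HOME = run/shared/lean/pub/decomp-res.  Host: route `MaxContactCut`,
aside 31770 `DefectWalksDeep`
through the tree's hypothesis-free `ExitLaw.defectWalksDeep_iff_joint'` and the lens-3 g15 node `Theorems/ConeCut*` (landed).

[WRITER NOTE (decomp-res writer g7): per the lens's own DELETE-ON-LANDING markers and critic row 123 h1 / row 130,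
the carried sections §V1
(g15 walk arithmetic = tree `Theorems/FloorCutFloor`), §V2 (g15 §A–§B residual-cone calculus up to the POWER
LAW = tree `Theorems/ConeCutLayers`,
`ConeCutLayersPoint`, `ConeCutWalks`) and §V3 (§AxisLaw = tree `Theorems/ConeCutAxisLaw`) are DELETED and the tree
modules imported/opened
instead (no third copy of the calculus; `exists_ne` is spelled `FloorCut.exists_ne` against Mathlib's root one); the
lens's `exists_third` (≡ tree `ConeCut.exists_third`, implicit binders) and `degree_eq_sum3`
(≡ `Finsupp.degree_eq_sum` + `Fin.sum_univ_three`, as in `FloorCutFloor`) are likewise replaced by the tree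
spellings; §L's VERBATIM g15
classes `IsTameFrom` / `NoMixedTailsDeep` / `NoTameMixedTailsDeep` are the landed `Theorems/ConeCutClasses` ones
(opened, not restated); §M
`closes` (≡ `MaxContactCutExponentLadder.closes`, a by-name re-export) is not restated.  Split: `ShadeCutLawJ`
(§J LAW J) · `ShadeCutTailTwo` /
`ShadeCutShadeTwo` (§S the shade-two theorem, PROVED; `section ShadeTwo` re-opened) · `MaxContactCutShadeCut` (§K
booking BY NAME to 31770 + §L letters).  ONE namespace `…Theorems.ShadeCut` as in the
lens; global `set_option` line dropped; the lens's `fin3_enum` (≡ the landed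
`Literature.RepresentationTheory.GeneralLinear.fin3_cases`,
dedup.landed) deleted: its two uses get a proof-local `have fin3_enum … := by decide`; nothing else changed.]
(Sources: Hauser2010 §§D,F,G; HauserPerlega2019; Moh1987; CossartPiltant2019; CossartJannsenSaito2020 Thm. 2.14,
§§5,9; BenitoVillamayor2013 §7; CasasAlvero2000 Ch. 3.)
-/

noncomputable section

open MvPolynomial Finset
open Literature.AlgebraicGeometry.Resolution
open Literature.AlgebraicGeometry.Resolution.Hauser2010
open Literature.AlgebraicGeometry.Resolution.PointBlowup
open Summit.ResolutionOfSingularities.ResolutionOfSingularities.Theses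
open Summit.ResolutionOfSingularities.ResolutionOfSingularities.Theorems.TightDefectClasses
open Summit.ResolutionOfSingularities.ResolutionOfSingularities.Theorems.TightDefectStrongWalks
open Summit.ResolutionOfSingularities.ResolutionOfSingularities.Theorems.ItineraryCutClasses
open Summit.ResolutionOfSingularities.ResolutionOfSingularities.Theorems.BoundaryLedger
open Summit.ResolutionOfSingularities.ResolutionOfSingularities.Theorems.ProximityCut
open Literature.AlgebraicGeometry.Resolution.WeightedBlowup
open Literature.Barriers.ResolutionOfSingularities
open Summit.ResolutionOfSingularities.ResolutionOfSingularities.Theorems.FloorCut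
open Summit.ResolutionOfSingularities.ResolutionOfSingularities.Theorems.ConeCutAxisLaw
open Summit.ResolutionOfSingularities.ResolutionOfSingularities.Theorems.ConeCut
open Summit.ResolutionOfSingularities.ResolutionOfSingularities.Theorems.ExitLaw (fin3_cases)

namespace Summit.ResolutionOfSingularities.ResolutionOfSingularities.Theorems.ShadeCut

/-! ## §K BOOKING — the shade axis of the joint residual: WINDOW `s = 2` DECIDED, residual RE-LOCATED at `s ≥ 3`
(EXACT), kernels BY NAME to aside 31770 `MaxContactCut.DefectWalksDeep` through the tree's hypothesis-free
`ExitLaw.defectWalksDeep_iff_joint'`. -/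

section Booking

/-- `q = p^e ≥ 4` in the deep range. [folklore] -/
theorem four_le_pow {p e : ℕ} (hp : p.Prime) (he : 2 ≤ e) : 4 ≤ p ^ e :=
  le_trans (by norm_num) (le_trans (Nat.pow_le_pow_right (by norm_num : 0 < 2) he) (Nat.pow_le_pow_left hp.two_le e))

/-- PIECE · THE SHADE-TWO WINDOW of the tree's joint residual `ExitLaw.NoRepeatTranslationRecurrentExcessPlateauxDeep`
(binders VERBATIM, plus the window clause `shade_N = 2`) · WEAKER than the joint residual by letter
(`shadeTwo_of_joint`) · **DECIDED — PROVED EMPTY** (`noShadeTwoJointTails_holds`, by LAW J + the boundary ledger +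
isolation): no infinite deep defect walk sits for ever on a plateau of shade `2` with positive excess, proximity
repeats infinitely often and translated moves infinitely often. -/
def NoShadeTwoJointTailsDeep : Prop :=
  ∀ p : ℕ, p.Prime → ∀ e : ℕ, 2 ≤ e → ∀ (K : Type) [Field K] [CharP K p] [PerfectField K] [DecidableEq K]
    (s₀ : State (Fin 3) K), IsRoot (p ^ e) s₀ → ∀ W : ForcedWalk (p ^ e) s₀, (∀ i, 1 ≤ (W.st i).shade) →
    ∀ N : ℕ, (∀ t, N ≤ t → (W.st (t + 1)).shade = (W.st t).shade) →
    (∀ t, N ≤ t → ordZero (W.st t).F ≠ ((p ^ e : ℕ) : ℕ∞)) → (∀ M : ℕ, ∃ t, M ≤ t ∧ StaysOnNewest W t) →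
    (∀ M : ℕ, ∃ t, M ≤ t ∧ W.b t ≠ 0) → (W.st N).shade = ((2 : ℕ) : ℕ∞) → False

/-- PIECE · THE LOCATED RESIDUAL OF THIS NODE — JOINT TAILS OF SHADE AT LEAST THREE (binders of the tree's joint
residual VERBATIM, plus `3 ≤ shade_N`) · WEAKER than the joint residual by letter (`three_of_joint`) · EXACT
(`joint_iff_three`: the shade-`1` slice is the tree's `FloorCut.noHighPlateaux_shade_one`, the shade-`2` slice is
`noShadeTwoJointTails_holds`) · UNDECIDED · IDEA-NEEDED (SEED-g17: the depth-2 law behind LAW J; the `s = 3` ledger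
automaton under ISO+J still has mixed translating cycles). -/
def NoJointTailsFromThreeDeep : Prop :=
  ∀ p : ℕ, p.Prime → ∀ e : ℕ, 2 ≤ e → ∀ (K : Type) [Field K] [CharP K p] [PerfectField K] [DecidableEq K]
    (s₀ : State (Fin 3) K), IsRoot (p ^ e) s₀ → ∀ W : ForcedWalk (p ^ e) s₀, (∀ i, 1 ≤ (W.st i).shade) →
    ∀ N : ℕ, (∀ t, N ≤ t → (W.st (t + 1)).shade = (W.st t).shade) →
    (∀ t, N ≤ t → ordZero (W.st t).F ≠ ((p ^ e : ℕ) : ℕ∞)) → (∀ M : ℕ, ∃ t, M ≤ t ∧ StaysOnNewest W t) →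
    (∀ M : ℕ, ∃ t, M ≤ t ∧ W.b t ≠ 0) → ((3 : ℕ) : ℕ∞) ≤ (W.st N).shade → False

/-- **THE SHADE-TWO WINDOW IS EMPTY (PROVED).** [new] [folklore] -/
theorem noShadeTwoJointTails_holds : NoShadeTwoJointTailsDeep := by
  intro p hp e he K _ _ _ _ s₀ hs W _ N hN hex hrec htr h2
  exact shadeTwo_tail_false hs (four_le_pow hp he) ⟨hN, h2, hex⟩ hrec htr

/-- Necessity of the window (by letter). [folklore] -/
theorem shadeTwo_of_joint (h : ExitLaw.NoRepeatTranslationRecurrentExcessPlateauxDeep) : NoShadeTwoJointTailsDeep :=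
  fun p hp e he K _ _ _ _ s₀ hs W hW N hN hex hrec htr _ => h p hp e he K s₀ hs W hW N hN hex hrec htr

/-- Necessity of the located residual (by letter). [folklore] -/
theorem three_of_joint (h : ExitLaw.NoRepeatTranslationRecurrentExcessPlateauxDeep) : NoJointTailsFromThreeDeep :=
  fun p hp e he K _ _ _ _ s₀ hs W hW N hN hex hrec htr _ => h p hp e he K s₀ hs W hW N hN hex hrec htr

/-- **SUFFICIENCY (PROVED)**: the residual at shades `≥ 3` gives back the whole joint residual — shade `1` by the
tree's height-one law, shade `2` by the shade-two theorem. [new] [folklore] -/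
theorem joint_of_three (h : NoJointTailsFromThreeDeep) : ExitLaw.NoRepeatTranslationRecurrentExcessPlateauxDeep := by
  intro p hp e he K _ _ _ _ s₀ hs W hW N hN hex hrec htr
  classical
  obtain ⟨o, ho, -⟩ := walk_nat hs W N
  obtain ⟨s, hsN, -⟩ := order_eq_shade_add_degree hs W N ho
  have h1 := hW N
  rw [hsN] at h1
  have hs1 : 1 ≤ s := by exact_mod_cast h1
  rcases (show s = 1 ∨ s = 2 ∨ 3 ≤ s by omega) with h' | h' | h'
  · subst h'
    refine FloorCut.noHighPlateaux_shade_one hs W (N := N) (fun t ht => ⟨shade_of_plateau W hN hsN t ht, ?_⟩) htr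
    obtain ⟨o', ho', hqo'⟩ := walk_nat hs W t
    have hne := hex t ht
    rw [ho'] at hne ⊢
    have hne' : o' ≠ p ^ e := by
      intro h''
      apply hne
      rw [h'']
    exact_mod_cast lt_of_le_of_ne hqo' (Ne.symm hne')
  · subst h'
    exact noShadeTwoJointTails_holds p hp e he K s₀ hs W hW N hN hex hrec htr hsN
  · exact h p hp e he K s₀ hs W hW N hN hex hrec htr (by rw [hsN]; exact_mod_cast h')

/-- **THE ONE CERTIFIED EQUIVALENCE OF THIS NODE (PROVED, EXACT)**: the tree's joint residual IS its slice at shades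
`≥ 3`. [new] [folklore] -/
theorem joint_iff_three : ExitLaw.NoRepeatTranslationRecurrentExcessPlateauxDeep ↔ NoJointTailsFromThreeDeep :=
  ⟨three_of_joint, joint_of_three⟩

/-- **KERNEL BY NAME (aside 31770)**: deep arc law ∧ the shade-`≥ 3` residual ⇒ `MaxContactCut.DefectWalksDeep`
(through the tree's `ExitLaw.closes₂'`). [new] [folklore] -/
theorem defectWalksDeep_of_three (hA : NoFreePointTailsDeep) (hR : NoJointTailsFromThreeDeep) :
    MaxContactCut.DefectWalksDeep :=
  ExitLaw.closes₂' hA (joint_of_three hR)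

/-- **THE EXACT CUT OF 31770 AFTER g16 (PROVED, hypothesis-free)**:
`MaxContactCut.DefectWalksDeep ↔ deep arc law ∧ joint tails of shade ≥ 3`. [new] [folklore] -/
theorem defectWalksDeep_iff_three :
    MaxContactCut.DefectWalksDeep ↔ NoFreePointTailsDeep ∧ NoJointTailsFromThreeDeep := by
  rw [ExitLaw.defectWalksDeep_iff_joint', joint_iff_three]

/-- Necessity of the located residual for 31770. [folklore] -/
theorem three_of_defectWalksDeep (h : MaxContactCut.DefectWalksDeep) : NoJointTailsFromThreeDeep :=
  (defectWalksDeep_iff_three.mp h).2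

end Booking

/-! ## §L LENS-3 VOCABULARY — g15's located residual `NoTameMixedTailsDeep` (VERBATIM) cut along the same axis:
`NoMixedTailsDeep ↔ NoMixedTailsFromThreeDeep`, `NoTameMixedTailsDeep ↔ NoTameMixedTailsFromThreeDeep` (EXACT). -/

/-- PIECE (lens-3 vocabulary) · MIXED TAILS OF SHADE AT LEAST THREE — `NoMixedTailsDeep` with `3 ≤ s` (binders
otherwise VERBATIM) · EXACT (`mixed_iff_fromThree`) · UNDECIDED. -/
def NoMixedTailsFromThreeDeep : Prop :=
  ∀ p : ℕ, p.Prime → ∀ e : ℕ, 2 ≤ e → ∀ (K : Type) [Field K] [CharP K p] [PerfectField K] [DecidableEq K]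
    (s₀ : State (Fin 3) K), IsRoot (p ^ e) s₀ → ∀ W : ForcedWalk (p ^ e) s₀,
    ∀ N s : ℕ, 3 ≤ s → s < p ^ e →
    (∀ t, N ≤ t → (W.st t).shade = (s : ℕ∞) ∧ ((p ^ e : ℕ) : ℕ∞) < ordZero (W.st t).F) →
    (∀ M : ℕ, ∃ i, M ≤ i ∧ W.b i ≠ 0) →
    (∀ M : ℕ, ∃ t, M ≤ t ∧ StaysOnNewest W t) → (∀ M : ℕ, ∃ t, M ≤ t ∧ LeavesNewest W t) → False

/-- PIECE (lens-3 vocabulary) · THE LOCATED RESIDUAL OF g15 AFTER g16 — TAME MIXED TAILS OF SHADE AT LEAST THREE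
(`NoTameMixedTailsDeep` with `3 ≤ s`, binders otherwise VERBATIM) · EXACT (`tameMixed_iff_fromThree`) · UNDECIDED. -/
def NoTameMixedTailsFromThreeDeep : Prop :=
  ∀ p : ℕ, p.Prime → ∀ e : ℕ, 2 ≤ e → ∀ (K : Type) [Field K] [CharP K p] [PerfectField K] [DecidableEq K]
    (s₀ : State (Fin 3) K), IsRoot (p ^ e) s₀ → ∀ W : ForcedWalk (p ^ e) s₀,
    ∀ N s : ℕ, 3 ≤ s → s < p ^ e →
    (∀ t, N ≤ t → (W.st t).shade = (s : ℕ∞) ∧ ((p ^ e : ℕ) : ℕ∞) < ordZero (W.st t).F) →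
    (∀ M : ℕ, ∃ i, M ≤ i ∧ W.b i ≠ 0) →
    (∀ M : ℕ, ∃ t, M ≤ t ∧ StaysOnNewest W t) → (∀ M : ℕ, ∃ t, M ≤ t ∧ LeavesNewest W t) →
    IsTameFrom W N → False

/-- **THE SHADE-TWO SLICE OF THE MIXED RESIDUAL IS EMPTY (PROVED)** — neither tameness nor the newest-free letter is
used. [new] [folklore] -/
theorem noMixedTails_shadeTwo {p e : ℕ} (hp : p.Prime) (he : 2 ≤ e) {K : Type} [Field K] [DecidableEq K]
    {s₀ : State (Fin 3) K} (hs : IsRoot (p ^ e) s₀) (W : ForcedWalk (p ^ e) s₀) (N : ℕ)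
    (hplat : ∀ t, N ≤ t → (W.st t).shade = ((2 : ℕ) : ℕ∞) ∧ ((p ^ e : ℕ) : ℕ∞) < ordZero (W.st t).F)
    (htr : ∀ M : ℕ, ∃ i, M ≤ i ∧ W.b i ≠ 0) (hR : ∀ M : ℕ, ∃ t, M ≤ t ∧ StaysOnNewest W t) : False :=
  shadeTwo_tail_false hs (four_le_pow hp he)
    ⟨fun t ht => by rw [(hplat (t + 1) (by omega)).1, (hplat t ht).1], (hplat N le_rfl).1,
      fun t ht => (hplat t ht).2.ne'⟩ hR htr

/-- **EXACT**: `NoMixedTailsDeep ↔ NoMixedTailsFromThreeDeep`. [new] [folklore] -/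
theorem mixed_iff_fromThree : NoMixedTailsDeep ↔ NoMixedTailsFromThreeDeep := by
  refine ⟨fun h p hp e he K _ _ _ _ s₀ hs W N s h3 hsq hplat htr hR hF =>
    h p hp e he K s₀ hs W N s (by omega) hsq hplat htr hR hF, fun h => ?_⟩
  intro p hp e he K _ _ _ _ s₀ hs W N s h2 hsq hplat htr hR hF
  by_cases h3 : 3 ≤ s
  · exact h p hp e he K s₀ hs W N s h3 hsq hplat htr hR hF
  · have h2' : s = 2 := by omega
    subst h2'
    exact noMixedTails_shadeTwo hp he hs W N hplat htr hR

/-- **EXACT**: g15's located residual IS its slice at shades `≥ 3`: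
`NoTameMixedTailsDeep ↔ NoTameMixedTailsFromThreeDeep`. [new] [folklore] -/
theorem tameMixed_iff_fromThree : NoTameMixedTailsDeep ↔ NoTameMixedTailsFromThreeDeep := by
  refine ⟨fun h p hp e he K _ _ _ _ s₀ hs W N s h3 hsq hplat htr hR hF hT =>
    h p hp e he K s₀ hs W N s (by omega) hsq hplat htr hR hF hT, fun h => ?_⟩
  intro p hp e he K _ _ _ _ s₀ hs W N s h2 hsq hplat htr hR hF hT
  by_cases h3 : 3 ≤ s
  · exact h p hp e he K s₀ hs W N s h3 hsq hplat htr hR hF hT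
  · have h2' : s = 2 := by omega
    subst h2'
    exact noMixedTails_shadeTwo hp he hs W N hplat htr hR

end Summit.ResolutionOfSingularities.ResolutionOfSingularities.Theorems.ShadeCut
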